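import Summits.RiemannHypothesis.RiemannHypothesis.Theorems.LiDirichletEchoImGammaShift
import Summits.RiemannHypothesis.RiemannHypothesis.Theorems.LiDirichletEchoImPrimeEdge
import Summits.RiemannHypothesis.RiemannHypothesis.Theorems.LiDirichletEchoImHorizontal
import Summits.RiemannHypothesis.RiemannHypothesis.Theorems.LiDirichletEchoImWindowAdjust
import Summits.RiemannHypothesis.RiemannHypothesis.Theorems.LiDirichletEchoComplexSplit
import Summits.RiemannHypothesis.RiemannHypothesis.Theorems.LiDirichletEchoLawProof
import HarnessLib

/-!
# RiemannHypothesis / LiDirichletEcho — the COMPLEX Li prime-echo law for Dirichlet characters is a theorem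
# (typed companion `LiTheory.LiZeroWindowEchoDirichletComplex`; RH-FREE, GRH-FREE)

RH-FREE · GRH-FREE [rh-li-eng g5].  The theory seat's typed COMPLEX companion of the closed leaf (`Theorems/LiEchoDirichletDefs.lean`,
«statement new»): for every primitive character `χ` mod `q > 1` and `c ≥ 5/4` there is `C` with

  `‖Σ_{√n<|Im ρ|≤c√n} m_ρ (1 − 1/ρ)ⁿ − S_χ(n; √n, c√n) + conj(χ(2)) · E₂(n)‖ ≤ C log² n`   (`n ≥ 2`),

`E₂(n) = liPrimeEcho 2 n = A₂ n^{1/4} cos(2√(n log 2) + π/4)` the REAL chirp.  REAL PART = the leaf (`liZeroWindowEchoDirichlet_proof`).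
IMAGINARY PART (this file): `Im W_C = +Im χ(2) · E₂ + O(log² n)` with NO smooth term — the cell's certified data law for complex
characters (DATA.md §P: fitted `(α_Re, α_Im) = (−Re χ(2), +Im χ(2))` to ±0.04 for 5.2, 5.3, 7.2, 7.4 on `[10⁴, 1.6·10⁷]`).  Proof:
per character, the antisymmetric contour identity (`ImContourChar.im_window_contour`) + the odd gamma shift
(`charGammaEdgeIm_bound`) + the antisymmetric prime edge (`charPrimeEdgeIm_bound`: `−A₂ n^{1/4}(Im χ(2) cos θ₀ − Re χ(2) sin θ₀)`)
+ good heights for both channels (`charHorizBoth_bound`) + window ends (`charImWindowAdjust_bound`) give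
`2 Im U_C(χ) = S⁻_χ + A₂ n^{1/4}(Im χ(2) cos θ₀ − Re χ(2) sin θ₀) + O(log² n)`; the odd smooth mean `S⁻` and the `sin θ₀` part are
the same for `χ` and `χ̄ = χ⁻¹` (`χ⁻¹(2) = conj χ(2)`), so `Im W_C = Im U_C(χ) − Im U_C(χ⁻¹)` (`charZeroTraceWindowC_im`) equals
`A₂ n^{1/4} Im χ(2) cos θ₀ = Im χ(2) · E₂` up to `O(log² n)`.  Unconditional: every zero of the window is summed whatever its real
part; nothing here bears on the truth of RH or GRH.
-/

noncomputable section

-- D-0017: `Summit.<S>.<S>.…` is the designed namespace of a single-problem summit.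
set_option linter.dupNamespace false

open scoped ComplexConjugate

namespace Summit.RiemannHypothesis.RiemannHypothesis.Theorems.LiTheory

open Literature.NumberTheory.LFunctions Literature.NumberTheory.LFunctions.DirichletTheta

namespace DirichletEchoComplex

open ImContourChar

/-- The odd smooth mean depends on `χ` only through `q` and the parity: `S⁻_{χ̄} = S⁻_χ`. -/
theorem charSmoothOddWindow_inv {q : ℕ} [NeZero q] (χ : DirichletCharacter ℂ q) (n : ℕ) (T₁ T₂ : ℝ) :
    charSmoothOddWindow χ⁻¹ n T₁ T₂ = charSmoothOddWindow χ n T₁ T₂ := by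
  simp [charSmoothOddWindow, charGammaDensity, DirichletEchoAssembly.charParity_inv]

/-- **PER-CHARACTER LAW, imaginary channel.**  For ONE primitive character and `c ≥ 5/4`:
`|2 Im U_C(χ; √n, c√n) − S⁻_χ(√n, c√n) − A₂ n^{1/4}(Im χ(2) cos θ₀ − Re χ(2) sin θ₀)| ≤ C log² n` for all large `n`. -/
theorem upper_law_im {q : ℕ} [NeZero q] (χ : DirichletCharacter ℂ q) (hprim : χ.IsPrimitive) (hq : 1 < q) {c : ℝ}
    (hc : 5 / 4 ≤ c) :
    ∃ N : ℕ, ∃ C : ℝ, ∀ n : ℕ, N ≤ n → 2 ≤ n →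
      |2 * (charUpperTraceWindowC χ n (Real.sqrt n) (c * Real.sqrt n)).im
          - charSmoothOddWindow χ n (Real.sqrt n) (c * Real.sqrt n)
          - liEchoAmp * (n : ℝ) ^ (1 / 4 : ℝ) *
            ((χ (2 : ZMod q)).im * Real.cos (2 * Real.sqrt (n * Real.log 2) + Real.pi / 4)
              - (χ (2 : ZMod q)).re * Real.sin (2 * Real.sqrt (n * Real.log 2) + Real.pi / 4))|
        ≤ C * Real.log n ^ 2 := by
  -- as `DirichletEchoAssembly.upper_law`, in the antisymmetric channel
  have h1 : χ ≠ 1 := ExplicitPsiChar.ne_one_of_isPrimitive hprim hq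
  have hc1 : (1 : ℝ) ≤ c := by linarith
  obtain ⟨N₄, C₄, h4⟩ := charGammaEdgeIm_bound χ c hc1
  obtain ⟨N₅, C₅, h5⟩ := charPrimeEdgeIm_bound (q := q) c hc
  obtain ⟨N₆, C₆, h6⟩ := charHorizBoth_bound χ hprim hq c hc1
  obtain ⟨N₇, C₇, h7⟩ := charImWindowAdjust_bound χ hprim hq c hc1
  set ℓ : ℝ := Real.log 2 with hℓ_def
  have hℓ : 0 < ℓ := Real.log_pos (by norm_num)
  refine ⟨max (max (max N₄ N₅) (max N₆ N₇)) 64, (3 * |C₇| + |C₄|) / ℓ + 2 * |C₆| + |C₅|, fun n hn h2 ↦ ?_⟩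
  have hn4 : N₄ ≤ n := by omega
  have hn5 : N₅ ≤ n := by omega
  have hn6 : N₆ ≤ n := by omega
  have hn7 : N₇ ≤ n := by omega
  have h64 : (64 : ℝ) ≤ n := by exact_mod_cast (show 64 ≤ n by omega)
  set s : ℝ := Real.sqrt n with hs_def
  have hs8 : 8 ≤ s := by
    have : Real.sqrt 64 = 8 := by
      rw [show (64 : ℝ) = 8 ^ 2 by norm_num]; exact Real.sqrt_sq (by norm_num)
    rw [← this]; exact Real.sqrt_le_sqrt h64
  have hs0 : 0 ≤ s := Real.sqrt_nonneg _
  have hcs : s ≤ c * s := le_mul_of_one_le_left hs0 hc1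
  have hgap : 2 ≤ (c - 1) * s := by
    have := mul_le_mul (show (1 / 4 : ℝ) ≤ c - 1 by linarith) hs8 (by norm_num) (by linarith)
    linarith
  obtain ⟨T₁, hT₁l, hT₁u, hgood₁, -, hH₁⟩ := h6 n hn6 s le_rfl hcs
  obtain ⟨T₂, hT₂l, hT₂u, hgood₂, -, hH₂⟩ := h6 n hn6 (c * s) hcs le_rfl
  have hlt : T₁ < T₂ := by nlinarith
  have hid := im_window_contour hprim h1 n (by linarith) hlt hgood₁ hgood₂
  rw [rightEdgeIm_split hprim h1 n T₁ T₂] at hid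
  have hgam := h4 n hn4 T₁ T₂ hT₁l hlt hT₂u
  have hpr := h5 χ n hn5 T₁ T₂ hT₁l hT₁u hT₂l hT₂u
  obtain ⟨hadjZ, hadjS⟩ := h7 n hn7 T₁ T₂ hT₁l hT₁u hT₂l hT₂u
  set E : ℝ := liEchoAmp * (n : ℝ) ^ (1 / 4 : ℝ) *
    ((χ (2 : ZMod q)).im * Real.cos (2 * Real.sqrt (n * Real.log 2) + Real.pi / 4)
      - (χ (2 : ZMod q)).re * Real.sin (2 * Real.sqrt (n * Real.log 2) + Real.pi / 4)) with hE
  have key : 2 * (charUpperTraceWindowC χ n s (c * s)).im - charSmoothOddWindow χ n s (c * s) - E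
      = 2 * ((charUpperTraceWindowC χ n s (c * s)).im - (charUpperTraceWindowC χ n T₁ T₂).im)
        - (charSmoothOddWindow χ n s (c * s) - charSmoothOddWindow χ n T₁ T₂)
        + (charGammaEdgeIm χ n T₁ T₂ - charSmoothOddWindow χ n T₁ T₂)
        - (charPrimeEdgeIm χ n T₁ T₂ + E)
        + charHorizRe χ n T₂ - charHorizRe χ n T₁ := by
    linear_combination hid
  rw [key]
  set L : ℝ := Real.log n with hL_def
  have hLℓ : ℓ ≤ L := Real.log_le_log (by norm_num) (by exact_mod_cast h2)
  have hL0 : 0 ≤ L := hℓ.le.trans hLℓ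
  have hL2 : L ≤ L ^ 2 / ℓ := by
    rw [le_div_iff₀ hℓ, sq]; exact mul_le_mul_of_nonneg_left hLℓ hL0
  have b1 : C₇ * L ≤ |C₇| * (L ^ 2 / ℓ) :=
    (mul_le_mul_of_nonneg_right (le_abs_self C₇) hL0).trans (mul_le_mul_of_nonneg_left hL2 (abs_nonneg _))
  have b4 : C₄ * L ≤ |C₄| * (L ^ 2 / ℓ) :=
    (mul_le_mul_of_nonneg_right (le_abs_self C₄) hL0).trans (mul_le_mul_of_nonneg_left hL2 (abs_nonneg _))
  have b5 : C₅ * L ^ 2 ≤ |C₅| * L ^ 2 := mul_le_mul_of_nonneg_right (le_abs_self C₅) (sq_nonneg _)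
  have b6 : C₆ * L ^ 2 ≤ |C₆| * L ^ 2 := mul_le_mul_of_nonneg_right (le_abs_self C₆) (sq_nonneg _)
  have e : ((3 * |C₇| + |C₄|) / ℓ + 2 * |C₆| + |C₅|) * L ^ 2
      = 3 * (|C₇| * (L ^ 2 / ℓ)) + |C₄| * (L ^ 2 / ℓ) + |C₅| * L ^ 2 + 2 * (|C₆| * L ^ 2) := by
    field_simp
    ring
  rw [e]
  rw [abs_le] at hadjZ hadjS hgam hpr hH₁ hH₂ ⊢
  constructor <;> linarith [hadjZ.1, hadjZ.2, hadjS.1, hadjS.2, hgam.1, hgam.2,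
    hpr.1, hpr.2, hH₁.1, hH₁.2, hH₂.1, hH₂.2]

/-- **IMAGINARY CHANNEL of the window law** (RH-FREE, GRH-FREE): for primitive `χ` mod `q > 1` and `c ≥ 5/4` there are `N`, `C`
with `|Im W_C(χ; √n, c√n) − Im χ(2) · E₂(n)| ≤ C log² n` for `n ≥ N` — no smooth term. -/
theorem im_law {q : ℕ} [NeZero q] (χ : DirichletCharacter ℂ q) (hprim : χ.IsPrimitive) (hq : 1 < q) {c : ℝ}
    (hc : 5 / 4 ≤ c) :
    ∃ N : ℕ, ∃ C : ℝ, ∀ n : ℕ, N ≤ n → 2 ≤ n →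
      |(charZeroTraceWindowC χ n (Real.sqrt n) (c * Real.sqrt n)).im - (χ (2 : ZMod q)).im * liPrimeEcho 2 n|
        ≤ C * Real.log n ^ 2 := by
  have hχ : χ ≠ 1 := ExplicitPsiChar.ne_one_of_isPrimitive hprim hq
  obtain ⟨N, C, hN⟩ := upper_law_im χ hprim hq hc
  obtain ⟨N', C', hN'⟩ := upper_law_im χ⁻¹ (Literature.NumberTheory.LFunctions.AutomorphicGRHOne.isPrimitive_inv hprim) hq hc
  refine ⟨max N N', (C + C') / 2, fun n hn h2 ↦ ?_⟩
  have h1 := hN n (le_of_max_le_left hn) h2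
  have h1' := hN' n (le_of_max_le_right hn) h2
  rw [charSmoothOddWindow_inv, Literature.NumberTheory.Sieve.Teravainen2024.inv_apply_eq_conj_apply, Complex.conj_re,
    Complex.conj_im] at h1'
  have hs0 : (0 : ℝ) ≤ Real.sqrt n := Real.sqrt_nonneg _
  have hcs : Real.sqrt n ≤ c * Real.sqrt n := le_mul_of_one_le_left hs0 (by linarith)
  rw [charZeroTraceWindowC_im χ hχ n hs0 hcs, liPrimeEcho_two]
  have key : (charUpperTraceWindowC χ n (Real.sqrt n) (c * Real.sqrt n)).im
        - (charUpperTraceWindowC χ⁻¹ n (Real.sqrt n) (c * Real.sqrt n)).im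
        - (χ (2 : ZMod q)).im * (liEchoAmp * ((n : ℝ) ^ (1 / 4 : ℝ) *
            Real.cos (2 * Real.sqrt (n * Real.log 2) + Real.pi / 4)))
      = ((2 * (charUpperTraceWindowC χ n (Real.sqrt n) (c * Real.sqrt n)).im
            - charSmoothOddWindow χ n (Real.sqrt n) (c * Real.sqrt n)
            - liEchoAmp * (n : ℝ) ^ (1 / 4 : ℝ) *
              ((χ (2 : ZMod q)).im * Real.cos (2 * Real.sqrt (n * Real.log 2) + Real.pi / 4)
                - (χ (2 : ZMod q)).re * Real.sin (2 * Real.sqrt (n * Real.log 2) + Real.pi / 4)))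
          - (2 * (charUpperTraceWindowC χ⁻¹ n (Real.sqrt n) (c * Real.sqrt n)).im
            - charSmoothOddWindow χ n (Real.sqrt n) (c * Real.sqrt n)
            - liEchoAmp * (n : ℝ) ^ (1 / 4 : ℝ) *
              (-(χ (2 : ZMod q)).im * Real.cos (2 * Real.sqrt (n * Real.log 2) + Real.pi / 4)
                - (χ (2 : ZMod q)).re * Real.sin (2 * Real.sqrt (n * Real.log 2) + Real.pi / 4)))) / 2 := by
    ring
  rw [key, abs_div, abs_two, div_le_iff₀ (by norm_num : (0 : ℝ) < 2)]
  calc |_| ≤ _ := abs_sub _ _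
    _ ≤ C * Real.log n ^ 2 + C' * Real.log n ^ 2 := add_le_add h1 h1'
    _ = (C + C') / 2 * Real.log n ^ 2 * 2 := by ring

end DirichletEchoComplex

open DirichletEchoComplex in
/-- **The COMPLEX Li prime-echo law for Dirichlet characters** (typed companion `LiZeroWindowEchoDirichletComplex`; RH-FREE,
GRH-FREE): real part = the leaf `liZeroWindowEchoDirichlet_proof`, imaginary part = `im_law`. -/
theorem liZeroWindowEchoDirichletComplex_holds : LiZeroWindowEchoDirichletComplex := by
  intro q _ χ hprim hq c hc
  obtain ⟨CR, hR⟩ := liZeroWindowEchoDirichlet_proof q χ hprim hq c hc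
  obtain ⟨N, CI, hI⟩ := im_law χ hprim hq hc
  set f : ℕ → ℝ := fun n ↦
    ‖charZeroTraceWindowC χ n (Real.sqrt n) (c * Real.sqrt n)
        - (charSmoothTraceWindow χ n (Real.sqrt n) (c * Real.sqrt n) : ℂ)
        + conj (χ (2 : ZMod q)) * (liPrimeEcho 2 n : ℂ)‖ with hf
  have hmain : ∀ n : ℕ, N ≤ n → 2 ≤ n → |f n| ≤ (CR + CI) * Real.log n ^ 2 := by
    intro n hn h2
    simp only [hf]
    rw [abs_of_nonneg (norm_nonneg _)]
    set x : ℂ := charZeroTraceWindowC χ n (Real.sqrt n) (c * Real.sqrt n)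
          - (charSmoothTraceWindow χ n (Real.sqrt n) (c * Real.sqrt n) : ℂ)
          + conj (χ (2 : ZMod q)) * (liPrimeEcho 2 n : ℂ) with hx
    have hre : x.re = charZeroTraceWindow χ n (Real.sqrt n) (c * Real.sqrt n)
        - charSmoothTraceWindow χ n (Real.sqrt n) (c * Real.sqrt n) + (χ (2 : ZMod q)).re * liPrimeEcho 2 n := by
      simp [hx, Complex.sub_re, Complex.add_re, charZeroTraceWindowC_re, Complex.mul_re, Complex.conj_re, Complex.conj_im,
        Complex.ofReal_re, Complex.ofReal_im]
    have him : x.im = (charZeroTraceWindowC χ n (Real.sqrt n) (c * Real.sqrt n)).im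
        - (χ (2 : ZMod q)).im * liPrimeEcho 2 n := by
      simp [hx, Complex.sub_im, Complex.add_im, Complex.mul_im, Complex.conj_re, Complex.conj_im, Complex.ofReal_re,
        Complex.ofReal_im]
      ring
    calc ‖x‖ ≤ |x.re| + |x.im| := Complex.norm_le_abs_re_add_abs_im x
      _ ≤ CR * Real.log n ^ 2 + CI * Real.log n ^ 2 := by
          rw [hre, him]; exact add_le_add (hR n h2) (hI n hn h2)
      _ = (CR + CI) * Real.log n ^ 2 := by ring
  obtain ⟨C', hC'⟩ := PrimeEchoAssembly.eventually_to_all f N (CR + CI) hmain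
  refine ⟨C', fun n hn ↦ ?_⟩
  have h := hC' n hn
  simp only [hf] at h
  rwa [abs_of_nonneg (norm_nonneg _)] at h

end Summit.RiemannHypothesis.RiemannHypothesis.Theorems.LiTheory

end
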